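import Literature.Geometry.DiscreteGeometry.KissingFanTriangleSets
import HarnessLib

/-!
# The wedge lemma at a vertex of the fan-refined hull triangulation of a spherical code

Topic `Literature/Geometry/DiscreteGeometry`; provefact brick for `Hales2012_contactGraphTame` /
`Hales2012_contactGraphFccOrHcp` (the "single-cycle vertex link" hypothesis of the finite
classification, `SphericalCodeHullVertexLink.lean`).  Let `X` be a finite set of unit vectors of
`ℝ³` with `0 ∈ interior (conv X)`, triangulated by the fan triangles `fanTriSets X`
(`KissingFanTriangleSets.lean`).  Fix a point `y ∈ X` and a fan triangle `t = {y, a, b}` at `y`.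
A **fan neighbour** of `y` is a point `n ≠ y` lying in a common fan triangle with `y`.

* `orient3_comb_left/mid/right` — trilinear expansion of the determinant along a combination
  `β a + γ b + λ y`;
* `mem_tightSet_of_wedge_comb` — **the functional step**: if a fan neighbour `n ∉ {a, b}` of `y`
  is a combination `n = β a + γ b + λ y` with `β, γ ≥ 0`, `β + γ > 0` (its tangent direction at
  `y` lies in the closed wedge of `t` at `y`), then `n` lies on the facet of `t`, and the facet
  of any fan triangle through `y, n` IS the facet of `t` (evaluate the two facet functionals:
  `1 = ⟪c', n⟫ = β⟪c', a⟫ + γ⟪c', b⟫ + λ ≤ β + γ + λ = ⟪c, n⟫ ≤ 1`, then three common tight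
  points, `eq_of_three_mem_tightSet`);
* **`not_wedge_comb`** — **the wedge lemma**: no fan neighbour `n ∉ {a, b}` of `y` is such a
  combination (inside one facet the vertices are in strictly convex position,
  `orient3_facetVertex_pos`, and the fan triangles from the apex `w 0` are explicit);
* `exists_comb_of_mem_fanTriSets` — `y, a, b` is a basis, so every `n` is SOME combination
  `β a + γ b + λ y`, with `orient3 y a n = γ · orient3 y a b`, `orient3 y n b = β · orient3 y a b`;
  hence the sign form **`not_sameSide_of_fanNbr`**: for a fan neighbour `n ∉ {a, b}` of `y` it
  is impossible that `orient3 y a n` and `orient3 y n b` both have (weakly, one strictly) the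
  sign of `orient3 y a b`.

## References
* T. C. Hales, arXiv:1209.6043 (2012), proof of Theorem 3 (the hypermap of the fan is that of a
  triangulated sphere). [`Hales2012`]
-/

noncomputable section

namespace Literature.Geometry.DiscreteGeometry

open Real RealInnerProductSpace Finset

section Wedge

variable {X : Finset (EuclideanSpace ℝ (Fin 3))}

/-! ### Part A. Trilinear expansions of `orient3` -/

/-- Expansion of `orient3` in the right argument along `β a + γ b + λ w`. [folklore] -/
theorem orient3_comb_right (u v a b w : (EuclideanSpace ℝ (Fin 3))) (β γ l : ℝ) :
    orient3 u v (β • a + γ • b + l • w) = β * orient3 u v a + γ * orient3 u v b + l * orient3 u v w := by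
  simp only [orient3, PiLp.add_apply, PiLp.smul_apply, smul_eq_mul]
  ring

/-- Expansion of `orient3` in the middle argument along `β a + γ b + λ w`. [folklore] -/
theorem orient3_comb_mid (u v a b w : (EuclideanSpace ℝ (Fin 3))) (β γ l : ℝ) :
    orient3 u (β • a + γ • b + l • w) v = β * orient3 u a v + γ * orient3 u b v + l * orient3 u w v := by
  simp only [orient3, PiLp.add_apply, PiLp.smul_apply, smul_eq_mul]
  ring

/-- Expansion of `orient3` in the left argument along `β a + γ b + λ w`. [folklore] -/
theorem orient3_comb_left (u v a b w : (EuclideanSpace ℝ (Fin 3))) (β γ l : ℝ) :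
    orient3 (β • a + γ • b + l • w) u v = β * orient3 a u v + γ * orient3 b u v + l * orient3 w u v := by
  simp only [orient3, PiLp.add_apply, PiLp.smul_apply, smul_eq_mul]
  ring

/-! ### Part B. The functional step -/

/-- **The functional step of the wedge lemma.**  Let `c, c'` be facet normals, `y, a, b` tight
for `c`, `y, n` tight for `c'`, with `y, n, a` pairwise distinct and `y, n, b` pairwise
distinct, and `n = β a + γ b + λ y` with `β, γ ≥ 0`, `β + γ > 0`.  Then `n` is tight for `c`
and `c' = c`. [folklore] -/
theorem mem_tightSet_of_wedge_comb (hX1 : ∀ y ∈ X, ‖y‖ = 1) {c c' : (EuclideanSpace ℝ (Fin 3))}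
    (hc : c ∈ facetNormals X) (hc' : c' ∈ facetNormals X) {y a b n : (EuclideanSpace ℝ (Fin 3))}
    (hy : y ∈ tightSet X c) (ha : a ∈ tightSet X c) (hb : b ∈ tightSet X c)
    (hy' : y ∈ tightSet X c') (hn' : n ∈ tightSet X c')
    (hyn : y ≠ n) (hya : y ≠ a) (hna : n ≠ a) (hyb : y ≠ b) (hnb : n ≠ b)
    {β γ l : ℝ} (hβ : 0 ≤ β) (hγ : 0 ≤ γ) (hβγ : 0 < β + γ) (hcomb : n = β • a + γ • b + l • y) :
    n ∈ tightSet X c ∧ c' = c := by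
  have hF := mem_facetNormals.1 hc
  have hF' := mem_facetNormals.1 hc'
  obtain ⟨hyX, hcy⟩ := mem_tightSet.1 hy
  obtain ⟨haX, hca⟩ := mem_tightSet.1 ha
  obtain ⟨hbX, hcb⟩ := mem_tightSet.1 hb
  obtain ⟨-, hc'y⟩ := mem_tightSet.1 hy'
  obtain ⟨hnX, hc'n⟩ := mem_tightSet.1 hn'
  -- evaluate the two functionals on `n`
  have hcn : ⟪c, n⟫ = β + γ + l := by
    rw [hcomb, inner_add_right, inner_add_right, real_inner_smul_right, real_inner_smul_right,
      real_inner_smul_right, hca, hcb, hcy]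
    ring
  have hc'n' : ⟪c', n⟫ = β * ⟪c', a⟫ + γ * ⟪c', b⟫ + l := by
    rw [hcomb, inner_add_right, inner_add_right, real_inner_smul_right, real_inner_smul_right,
      real_inner_smul_right, hc'y]
    ring
  have hle : ⟪c, n⟫ ≤ 1 := hF.1 n hnX
  have ha1 : ⟪c', a⟫ ≤ 1 := hF'.1 a haX
  have hb1 : ⟪c', b⟫ ≤ 1 := hF'.1 b hbX
  have h1 : β * (1 - ⟪c', a⟫) + γ * (1 - ⟪c', b⟫) + (1 - ⟪c, n⟫) = 0 := by
    rw [hcn]; rw [hc'n] at hc'n'; linarith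
  have t1 : 0 ≤ β * (1 - ⟪c', a⟫) := mul_nonneg hβ (by linarith)
  have t2 : 0 ≤ γ * (1 - ⟪c', b⟫) := mul_nonneg hγ (by linarith)
  have hcn1 : ⟪c, n⟫ = 1 := by linarith
  have hn : n ∈ tightSet X c := mem_tightSet.2 ⟨hnX, hcn1⟩
  refine ⟨hn, ?_⟩
  -- one of `a, b` is tight for `c'` as well: three common tight points
  by_cases hβ0 : β = 0
  · have hγ0 : 0 < γ := by rw [hβ0, zero_add] at hβγ; exact hβγ
    have hb' : ⟪c', b⟫ = 1 := by
      have : γ * (1 - ⟪c', b⟫) = 0 := by linarith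
      rcases mul_eq_zero.1 this with h | h
      · exact absurd h hγ0.ne'
      · linarith
    have hb'' : b ∈ tightSet X c' := mem_tightSet.2 ⟨hbX, hb'⟩
    exact (eq_of_three_mem_tightSet hX1 hc hy hn hb hy' hn' hb'' hyn hyb hnb).symm
  · have hβ0' : 0 < β := lt_of_le_of_ne hβ (Ne.symm hβ0)
    have ha' : ⟪c', a⟫ = 1 := by
      have : β * (1 - ⟪c', a⟫) = 0 := by linarith
      rcases mul_eq_zero.1 this with h | h
      · exact absurd h hβ0'.ne'
      · linarith
    have ha'' : a ∈ tightSet X c' := mem_tightSet.2 ⟨haX, ha'⟩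
    exact (eq_of_three_mem_tightSet hX1 hc hy hn ha hy' hn' ha'' hyn hya hna).symm

/-! ### Part C. The wedge lemma -/

/-- Positivity of cyclically ordered facet vertices, in `fVert` form. [folklore] -/
theorem orient3_fVert_pos (hX1 : ∀ y ∈ X, ‖y‖ = 1) {c : (EuclideanSpace ℝ (Fin 3))} (hc : c ∈ facetNormals X)
    {i j k : ℕ} (hij : i < j) (hjk : j < k) (hk : k < (tightSet X c).card) :
    0 < orient3 (fVert X c i) (fVert X c j) (fVert X c k) := by
  have hc0 := ne_zero_of_mem_facetNormals hX1 hc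
  rw [fVert_eq hc0, fVert_eq hc0, fVert_eq hc0]
  exact orient3_facetVertex_pos hX1 hc hij hjk (by rwa [card_facetAngles hX1 hc0])

/-- **The wedge lemma.**  Let `t = {y, a, b}` be a fan triangle (three distinct vertices) and
`n` a fan neighbour of `y` (`y, n ∈ t'` for a fan triangle `t'`, `n ≠ y`) with `n ≠ a`,
`n ≠ b`.  Then `n` is not a combination `β a + γ b + λ y` with `β, γ ≥ 0`, `β + γ > 0` (the
tangent direction of `n` at `y` is not in the closed wedge of `t` at `y`). [folklore] -/
theorem not_wedge_comb (hX1 : ∀ y ∈ X, ‖y‖ = 1) {t t' : Finset (EuclideanSpace ℝ (Fin 3))} (ht : t ∈ fanTriSets X)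
    (ht' : t' ∈ fanTriSets X) {y a b n : (EuclideanSpace ℝ (Fin 3))} (hty : t = {y, a, b}) (hya : y ≠ a) (hyb : y ≠ b)
    (hab : a ≠ b) (hyt' : y ∈ t') (hnt' : n ∈ t') (hyn : y ≠ n) (hna : n ≠ a) (hnb : n ≠ b)
    {β γ l : ℝ} (hβ : 0 ≤ β) (hγ : 0 ≤ γ) (hβγ : 0 < β + γ) (hcomb : n = β • a + γ • b + l • y) :
    False := by
  obtain ⟨⟨c, i⟩, hp, hpt⟩ := mem_fanTriSets.1 ht
  obtain ⟨⟨c', i'⟩, hp', hpt'⟩ := mem_fanTriSets.1 ht'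
  obtain ⟨hc, hi⟩ := mem_fanTriangles.1 hp
  obtain ⟨hc', hi'⟩ := mem_fanTriangles.1 hp'
  simp only at hc hi hc' hi'
  have hsub : t ⊆ tightSet X c := hpt ▸ fanVerts_subset_tightSet hX1 hp
  have hsub' : t' ⊆ tightSet X c' := hpt' ▸ fanVerts_subset_tightSet hX1 hp'
  have hyt : y ∈ t := by rw [hty]; simp
  have hat : a ∈ t := by rw [hty]; simp
  have hbt : b ∈ t := by rw [hty]; simp
  obtain ⟨-, hcc⟩ := mem_tightSet_of_wedge_comb hX1 hc hc' (hsub hyt) (hsub hat) (hsub hbt)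
    (hsub' hyt') (hsub' hnt') hyn hya hna hyb hnb hβ hγ hβγ hcomb
  have hcc' := hcc.symm
  subst hcc'
  -- everything happens on the facet of `c`; name its vertices
  set w : ℕ → (EuclideanSpace ℝ (Fin 3)) := fVert X c with hw
  set m := (tightSet X c).card with hm
  have winj : ∀ {j k : ℕ}, j < m → k < m → w j = w k → j = k := fun hj hk h =>
    fVert_injective_of_lt hX1 hc hj hk h
  have opos : ∀ {j k q : ℕ}, j < k → k < q → q < m → 0 < orient3 (w j) (w k) (w q) :=
    fun hjk hkq hq => orient3_fVert_pos hX1 hc hjk hkq hq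
  have O := opos (j := 0) (k := i + 1) (q := i + 2) (by omega) (by omega) hi
  have htv : t = {w 0, w (i + 1), w (i + 2)} := by rw [← hpt, hw]; rfl
  have htv' : t' = {w 0, w (i' + 1), w (i' + 2)} := by rw [← hpt', hw]; rfl
  have hnt : n ∉ t := by
    rw [hty]; simp only [Finset.mem_insert, Finset.mem_singleton, not_or]
    exact ⟨fun h => hyn h.symm, hna, hnb⟩
  -- useful vanishing products
  have key : ∀ {x : ℝ}, 0 ≤ x → 0 < x * -orient3 (w 0) (w (i + 1)) (w (i + 2)) → False :=
    fun hx h => by nlinarith [mul_nonneg hx O.le]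
  -- position of `y` in `t`
  have hy3 : y = w 0 ∨ y = w (i + 1) ∨ y = w (i + 2) := by
    have := hyt; rw [htv] at this; simpa only [Finset.mem_insert, Finset.mem_singleton] using this
  have hn3 : n = w 0 ∨ n = w (i' + 1) ∨ n = w (i' + 2) := by
    have := hnt'; rw [htv'] at this; simpa only [Finset.mem_insert, Finset.mem_singleton] using this
  rcases hy3 with hy0 | hy1 | hy2
  · -- `y = w 0`: `{a, b} = {w (i+1), w (i+2)}`, `n = w k` with `k ∉ {0, i+1, i+2}`
    have hpair : ({a, b} : Finset (EuclideanSpace ℝ (Fin 3))) = {w (i + 1), w (i + 2)} := by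
      refine pair_eq_of_triple_eq (y := y) (by rw [← hty, htv, hy0]) hya hyb ?_ ?_
      · rw [hy0]; exact fun h => absurd (winj (by omega) (by omega) h) (by omega)
      · rw [hy0]; exact fun h => absurd (winj (by omega) hi h) (by omega)
    -- `n = w k`, `1 ≤ k < m`, `k ≠ i+1, i+2`
    obtain ⟨k, hk, hk0, rfl⟩ : ∃ k, k < m ∧ 0 < k ∧ n = w k := by
      rcases hn3 with h | h | h
      · exact absurd (h.trans hy0.symm) (Ne.symm hyn)
      · exact ⟨i' + 1, by omega, by omega, h⟩
      · exact ⟨i' + 2, hi', by omega, h⟩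
    rcases pair_eq_pair_cases hpair with ⟨rfl, rfl⟩ | ⟨rfl, rfl⟩
    · -- `a = w (i+1)`, `b = w (i+2)`
      have hk1 : k ≠ i + 1 := fun h => hna (by rw [h])
      have hk2 : k ≠ i + 2 := fun h => hnb (by rw [h])
      rcases Nat.lt_or_gt_of_ne hk2 with hlt | hgt
      · -- `k < i+1`: `0 < orient3 (w 0) (w k) (w (i+1)) = orient3 y n a`
        have h := opos (j := 0) (k := k) (q := i + 1) hk0 (by omega) (by omega)
        rw [← hy0, hcomb, orient3_comb_mid] at h
        simp only [orient3_self_right, orient3_self_left, mul_zero, zero_add, add_zero] at h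
        rw [hy0, orient3_swap_right] at h
        exact key hγ h
      · -- `k > i+2`: `0 < orient3 (w 0) (w (i+2)) (w k) = orient3 y b n`
        have h := opos (j := 0) (k := i + 2) (q := k) (by omega) hgt hk
        rw [← hy0, hcomb, orient3_comb_right] at h
        simp only [orient3_self_right, orient3_self_outer, mul_zero, add_zero] at h
        rw [hy0, orient3_swap_right] at h
        exact key hβ h
    · -- `a = w (i+2)`, `b = w (i+1)`
      have hk1 : k ≠ i + 1 := fun h => hnb (by rw [h])
      have hk2 : k ≠ i + 2 := fun h => hna (by rw [h])
      rcases Nat.lt_or_gt_of_ne hk2 with hlt | hgt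
      · have h := opos (j := 0) (k := k) (q := i + 1) hk0 (by omega) (by omega)
        rw [← hy0, hcomb, orient3_comb_mid] at h
        simp only [orient3_self_right, orient3_self_left, mul_zero, add_zero] at h
        rw [hy0, orient3_swap_right] at h
        exact key hβ h
      · have h := opos (j := 0) (k := i + 2) (q := k) (by omega) hgt hk
        rw [← hy0, hcomb, orient3_comb_right] at h
        simp only [orient3_self_right, orient3_self_outer, mul_zero, add_zero, zero_add] at h
        rw [hy0, orient3_swap_right] at h
        exact key hγ h
  · -- `y = w (i+1)`: `{a, b} = {w 0, w (i+2)}`, `t' = (c, i-1)`, `n = w i`, `i ≥ 1`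
    have hpair : ({a, b} : Finset (EuclideanSpace ℝ (Fin 3))) = {w 0, w (i + 2)} := by
      refine pair_eq_of_triple_eq (y := y) ?_ hya hyb ?_ ?_
      · rw [← hty, htv, hy1]
        ext z; simp only [Finset.mem_insert, Finset.mem_singleton]; tauto
      · rw [hy1]; exact fun h => absurd (winj (by omega) (by omega) h) (by omega)
      · rw [hy1]; exact fun h => absurd (winj (by omega) hi h) (by omega)
    -- `y ∈ t'` pins down `i'`
    have hy3' : y = w 0 ∨ y = w (i' + 1) ∨ y = w (i' + 2) := by
      have := hyt'; rw [htv'] at this; simpa only [Finset.mem_insert, Finset.mem_singleton] using this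
    have hi'eq : i' + 2 = i + 1 := by
      rcases hy3' with h | h | h
      · exact absurd (winj (by omega) (by omega) (hy1.symm.trans h)) (by omega)
      · have := winj (by omega) (by omega) (hy1.symm.trans h)
        -- `i' = i`: then `t' = t`
        exfalso; apply hnt
        rw [htv, show i = i' by omega, ← htv']; exact hnt'
      · exact (winj (by omega) (by omega) (hy1.symm.trans h)).symm
    have hnw : n = w i := by
      rcases hn3 with h | h | h
      · exfalso; apply hnt; rw [hty, h]
        have : w 0 ∈ ({a, b} : Finset (EuclideanSpace ℝ (Fin 3))) := by rw [hpair]; simp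
        simp only [Finset.mem_insert, Finset.mem_singleton] at this ⊢
        rcases this with h' | h'
        · exact Or.inr (Or.inl h')
        · exact Or.inr (Or.inr h')
      · rw [h]; congr 1; omega
      · exact absurd (hy1.trans (by rw [hi'eq]) |>.trans h.symm) hyn
    have hi1 : 1 ≤ i := by omega
    have h := opos (j := 0) (k := i) (q := i + 1) (by omega) (by omega) (by omega)
    rcases pair_eq_pair_cases hpair with ⟨rfl, rfl⟩ | ⟨rfl, rfl⟩
    · -- `a = w 0`, `b = w (i+2)`: `orient3 a n y`
      rw [← hy1] at h
      rw [show w i = n from hnw.symm, hcomb, orient3_comb_mid] at h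
      simp only [orient3_self_left, orient3_self_right, mul_zero, zero_add, add_zero] at h
      rw [hy1, orient3_swap_right] at h
      exact key hγ h
    · -- `a = w (i+2)`, `b = w 0`
      rw [← hy1] at h
      rw [show w i = n from hnw.symm, hcomb, orient3_comb_mid] at h
      simp only [orient3_self_left, orient3_self_right, mul_zero, add_zero] at h
      rw [hy1, orient3_swap_right] at h
      exact key hβ h
  · -- `y = w (i+2)`: `{a, b} = {w 0, w (i+1)}`, `t' = (c, i+1)`, `n = w (i+3)`
    have hpair : ({a, b} : Finset (EuclideanSpace ℝ (Fin 3))) = {w 0, w (i + 1)} := by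
      refine pair_eq_of_triple_eq (y := y) ?_ hya hyb ?_ ?_
      · rw [← hty, htv, hy2]
        ext z; simp only [Finset.mem_insert, Finset.mem_singleton]; tauto
      · rw [hy2]; exact fun h => absurd (winj hi (by omega) h) (by omega)
      · rw [hy2]; exact fun h => absurd (winj hi (by omega) h) (by omega)
    have hy3' : y = w 0 ∨ y = w (i' + 1) ∨ y = w (i' + 2) := by
      have := hyt'; rw [htv'] at this; simpa only [Finset.mem_insert, Finset.mem_singleton] using this
    have hi'eq : i' + 1 = i + 2 := by
      rcases hy3' with h | h | h
      · exact absurd (winj hi (by omega) (hy2.symm.trans h)) (by omega)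
      · exact (winj hi (by omega) (hy2.symm.trans h)).symm
      · have := winj hi hi' (hy2.symm.trans h)
        exfalso; apply hnt
        rw [htv, show i = i' by omega, ← htv']; exact hnt'
    have hnw : n = w (i + 3) := by
      rcases hn3 with h | h | h
      · exfalso; apply hnt; rw [hty, h]
        have : w 0 ∈ ({a, b} : Finset (EuclideanSpace ℝ (Fin 3))) := by rw [hpair]; simp
        simp only [Finset.mem_insert, Finset.mem_singleton] at this ⊢
        rcases this with h' | h'
        · exact Or.inr (Or.inl h')
        · exact Or.inr (Or.inr h')
      · exact absurd (hy2.trans (by rw [hi'eq]) |>.trans h.symm) hyn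
      · rw [h]; congr 1; omega
    have hi3 : i + 3 < m := by omega
    have h := opos (j := 0) (k := i + 2) (q := i + 3) (by omega) (by omega) hi3
    rcases pair_eq_pair_cases hpair with ⟨rfl, rfl⟩ | ⟨rfl, rfl⟩
    · -- `a = w 0`, `b = w (i+1)`: `orient3 a y n`
      rw [← hy2, ← hnw, hcomb, orient3_comb_right] at h
      simp only [orient3_self_right, orient3_self_outer, mul_zero, zero_add, add_zero] at h
      rw [hy2, orient3_swap_right] at h
      exact key hγ h
    · -- `a = w (i+1)`, `b = w 0`
      rw [← hy2, ← hnw, hcomb, orient3_comb_right] at h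
      simp only [orient3_self_right, orient3_self_outer, mul_zero, add_zero] at h
      rw [hy2, orient3_swap_right] at h
      exact key hβ h

/-! ### Part D. The sign form -/

/-- Three distinct tight points of a facet have nonzero determinant (they are in strictly
convex position after sorting, `orient3_facetVertex_pos`). [folklore] -/
theorem orient3_ne_zero_of_three_tight (hX1 : ∀ y ∈ X, ‖y‖ = 1) {c : (EuclideanSpace ℝ (Fin 3))}
    (hc : c ∈ facetNormals X) {y₁ y₂ y₃ : (EuclideanSpace ℝ (Fin 3))} (h₁ : y₁ ∈ tightSet X c) (h₂ : y₂ ∈ tightSet X c)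
    (h₃ : y₃ ∈ tightSet X c) (h12 : y₁ ≠ y₂) (h13 : y₁ ≠ y₃) (h23 : y₂ ≠ y₃) :
    orient3 y₁ y₂ y₃ ≠ 0 := by
  set hc0 := ne_zero_of_mem_facetNormals hX1 hc
  obtain ⟨i, hi, rfl⟩ := exists_facetVertex_eq hX1 hc0 h₁
  obtain ⟨j, hj, rfl⟩ := exists_facetVertex_eq hX1 hc0 h₂
  obtain ⟨k, hk, rfl⟩ := exists_facetVertex_eq hX1 hc0 h₃
  have hij : i ≠ j := fun h => h12 (by rw [h])
  have hik : i ≠ k := fun h => h13 (by rw [h])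
  have hjk : j ≠ k := fun h => h23 (by rw [h])
  have hpos := fun (a b d : ℕ) (hab : a < b) (hbd : b < d) (hd : d < (facetAngles X c hc0).card) =>
    orient3_facetVertex_pos hX1 hc hab hbd hd
  rcases Nat.lt_or_gt_of_ne hij with hij' | hij' <;> rcases Nat.lt_or_gt_of_ne hjk with hjk' | hjk'
    <;> rcases Nat.lt_or_gt_of_ne hik with hik' | hik'
  · exact (hpos i j k hij' hjk' hk).ne'
  · omega
  · rw [orient3_swap_right]; exact neg_ne_zero.2 (hpos i k j hik' hjk' hj).ne'
  · rw [← orient3_cyclic]; exact (hpos k i j hik' hij' hj).ne'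
  · rw [orient3_swap_left]; exact neg_ne_zero.2 (hpos j i k hij' hik' hk).ne'
  · rw [orient3_cyclic]; exact (hpos j k i hjk' hik' hi).ne'
  · omega
  · rw [orient3_swap_outer]; exact neg_ne_zero.2 (hpos k j i hjk' hij' hi).ne'

/-- Every vector is a combination `β a + γ b + λ y` of three linearly independent vectors
`y, a, b` of `ℝ³`. [folklore] -/
theorem exists_comb_of_linearIndependent {y a b : (EuclideanSpace ℝ (Fin 3))} (hli : LinearIndependent ℝ ![y, a, b])
    (n : (EuclideanSpace ℝ (Fin 3))) : ∃ β γ l : ℝ, n = β • a + γ • b + l • y := by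
  have hspan := hli.span_eq_top_of_card_eq_finrank (by simp)
  have hn : n ∈ Submodule.span ℝ (Set.range ![y, a, b]) := by rw [hspan]; trivial
  obtain ⟨f, hf⟩ := (Submodule.mem_span_range_iff_exists_fun ℝ).1 hn
  refine ⟨f 1, f 2, f 0, ?_⟩
  rw [← hf, Fin.sum_univ_three]
  simp only [Matrix.cons_val_zero, Matrix.cons_val_one, Matrix.cons_val]
  abel

/-- **The wedge lemma, sign form.**  For a fan triangle `t = {y, a, b}` and a fan neighbour
`n ∉ {a, b}` of `y`, it is impossible that `orient3 y a n` and `orient3 y n b` both have,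
weakly and at least one of them strictly, the sign of `orient3 y a b` (that would put the
tangent direction of `n` at `y` inside the closed wedge of `t`). [folklore] -/
theorem not_sameSide_of_fanNbr (hX1 : ∀ y ∈ X, ‖y‖ = 1) {t t' : Finset (EuclideanSpace ℝ (Fin 3))}
    (ht : t ∈ fanTriSets X) (ht' : t' ∈ fanTriSets X) {y a b n : (EuclideanSpace ℝ (Fin 3))} (hty : t = {y, a, b})
    (hya : y ≠ a) (hyb : y ≠ b) (hab : a ≠ b) (hyt' : y ∈ t') (hnt' : n ∈ t') (hyn : y ≠ n)
    (hna : n ≠ a) (hnb : n ≠ b) :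
    ¬ (0 ≤ orient3 y a b * orient3 y a n ∧ 0 ≤ orient3 y a b * orient3 y n b ∧
      (0 < orient3 y a b * orient3 y a n ∨ 0 < orient3 y a b * orient3 y n b)) := by
  rintro ⟨h1, h2, h3⟩
  obtain ⟨p, hp, hpt⟩ := mem_fanTriSets.1 ht
  have hc := (mem_fanTriangles.1 hp).1
  have hsub : t ⊆ tightSet X p.1 := hpt ▸ fanVerts_subset_tightSet hX1 hp
  have hyt : y ∈ t := by rw [hty]; simp
  have hat : a ∈ t := by rw [hty]; simp
  have hbt : b ∈ t := by rw [hty]; simp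
  have hli := linearIndependent_of_three_tight hX1 hc (hsub hyt) (hsub hat) (hsub hbt) hya hyb hab
  have hO := orient3_ne_zero_of_three_tight hX1 hc (hsub hyt) (hsub hat) (hsub hbt) hya hyb hab
  obtain ⟨β, γ, l, hcomb⟩ := exists_comb_of_linearIndependent hli n
  have e1 : orient3 y a n = γ * orient3 y a b := by
    rw [hcomb, orient3_comb_right]
    simp only [orient3_self_right, orient3_self_outer, mul_zero, zero_add, add_zero]
  have e2 : orient3 y n b = β * orient3 y a b := by
    rw [hcomb, orient3_comb_mid]
    simp only [orient3_self_right, orient3_self_left, mul_zero, add_zero]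
  rw [e1] at h1 h3
  rw [e2] at h2 h3
  have hO2 : 0 < orient3 y a b ^ 2 := by positivity
  have hγ : 0 ≤ γ := by nlinarith
  have hβ : 0 ≤ β := by nlinarith
  have hβγ : 0 < β + γ := by
    rcases h3 with h | h
    · have : 0 < γ := by nlinarith
      linarith
    · have : 0 < β := by nlinarith
      linarith
  exact not_wedge_comb hX1 ht ht' hty hya hyb hab hyt' hnt' hyn hna hnb hβ hγ hβγ hcomb

end Wedge

end Literature.Geometry.DiscreteGeometry
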